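import Summits.CriticalPhenomena.CardyFormulaZ2.Theorems.CardyAnchoredRigiditySubseqCardyBoxLimits

/-!
# Super-multiplicativity of the long-box values of a joint sequential limit
# (crux `SubseqCardy`, stmt-CriticalPhenomena-5768, line `registered`, lead c6: kernel facts IV, part 1)

Route `CardyAnchoredRigidity` (decl shared with `CardyLocalRigidity`), sub-problem `CardyFormulaZ2`.
For a JOINT SEQUENTIAL LIMIT (`u → 0⁺`, `g`) of the bond-`ℤ²` crossing probabilities write
`ℓ(w) = g (L_w)` for a conformal rectangle `L_w` with carrier `(0,w) × (0,1)`, arc `0` its left side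
and arc `2` its right side. Part 2 of the kernel facts (`JointLimit.lr_submul`) is the upper gluing
bound `ℓ(w₁ + w₂) ≤ ℓ(w₁) ℓ(w₂)`; here we prove the CONVERSE gluing inequality

* `JointLimit.lr_supermul` — **`ℓ(w₁) ℓ(w₂) / 2 ≤ ℓ(w₁ + w₂ - 1)`** for `w₁, w₂ ≥ 1`,

registered as the sub-goal `jointLimit_lr_supermul`. Together with `lr_submul` it makes `-log ℓ`
quasi-additive, whence the strip crossing exponent (Fekete) of the lead's skeleton.

Proof. STRICT widths `w < w₁ + w₂ - 1` (`JointLimit.lr_supermul_of_lt`): along the fitted meshes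
`1/m`, `m = ⌊1/u n⌋₊` (which carry the joint limit, `tendsto_fitted`), the three values are EXACT
lattice crossing probabilities `h(a₁, m-2)`, `h(a₂, m-2)`, `h(a, m-2)` with `aᵢ + 1 < wᵢ m ≤ aᵢ + 2`,
`a + 1 < w m ≤ a + 2` (`eventually_lr_eq`). Harris/FKG gluing of two long crossings through the
square (`crossingProb_glue_holds`: `h(a₁, n) h(a₂, n) h(n, n) ≤ h(a₁ + a₂ - n, n)` for `n ≤ aᵢ`),
`h(n, n) ≥ 1/2` at `p = 1/2` (`half_le_crossingProb_self`) and width monotonicity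
(`crossingProb_anti_left`, the index inequality `a ≤ a₁ + a₂ - (m - 2)` holding as soon as
`(w₁ + w₂ - 1 - w) m ≥ 1`) give the inequality at every large fitted mesh, hence in the limit.
The width `w₁ + w₂ - 1` itself follows from the continuity of `ℓ` (`JointLimit.lr_continuous`).

References: B. Bollobás, O. Riordan, *Percolation* (2006), Ch. 3, eq. (2) and eq. (12);
G. Grimmett, *Percolation* (1999), Lemma 11.75.
-/

noncomputable section

namespace Summit.CriticalPhenomena.CardyFormulaZ2.Cruxes.SubseqCardy.Birth

open Set Filter Topology Metric
open Literature.Probability.RandomPlanarGeometry (ConformalRectangle MarkedDomain)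
open Literature.Probability.LatticeModels
open Literature.Probability.Percolation (bondDomainCrossingProb crossingProb half crossingProb_anti_left
  crossingProb_mem_Icc crossingProb_glue_holds half_le_crossingProb_self crossingProb_half_succ_self_holds)

namespace JointLimit

variable {u : ℕ → ℝ} {g : ConformalRectangle → ℝ}

/-! ### The lattice gluing inequality at one mesh -/

/-- **Gluing two long crossings through a square, lattice form**: for `n ≤ a₁`, `n ≤ a₂` and
`a ≤ a₁ + a₂ - n`, `h(a₁, n) h(a₂, n) / 2 ≤ h(a, n)` at `p = 1/2` (Harris gluing
`h(a₁, n) h(a₂, n) h(n, n) ≤ h(a₁ + a₂ - n, n)`, `h(n, n) ≥ 1/2`, monotonicity in the width).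
[cite: BollobasRiordan2006, Ch. 3, eq. (2) and eq. (12)] -/
theorem crossingProb_mul_half_le {a₁ a₂ a n : ℕ} (hn₁ : n ≤ a₁) (hn₂ : n ≤ a₂)
    (ha : a ≤ a₁ + a₂ - n) :
    crossingProb half a₁ n * crossingProb half a₂ n / 2 ≤ crossingProb half a n := by
  have hS : 1 / 2 ≤ crossingProb half n n := half_le_crossingProb_self crossingProb_half_succ_self_holds n
  have hP : 0 ≤ crossingProb half a₁ n * crossingProb half a₂ n :=
    mul_nonneg (crossingProb_mem_Icc half a₁ n).1 (crossingProb_mem_Icc half a₂ n).1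
  calc crossingProb half a₁ n * crossingProb half a₂ n / 2
      = crossingProb half a₁ n * crossingProb half a₂ n * (1 / 2) := div_eq_mul_one_div _ _
    _ ≤ crossingProb half a₁ n * crossingProb half a₂ n * crossingProb half n n :=
        mul_le_mul_of_nonneg_left hS hP
    _ ≤ crossingProb half (a₁ + a₂ - n) n := crossingProb_glue_holds half a₁ a₂ n hn₁ hn₂
    _ ≤ crossingProb half a n := crossingProb_anti_left half ha n

/-! ### Super-multiplicativity in the width -/

/-- **Super-multiplicativity of the left-to-right box values of a joint limit, strict widths**:
`g (L_{w₁}) · g (L_{w₂}) / 2 ≤ g (L_w)` for `w₁, w₂ ≥ 1` and `0 < w < w₁ + w₂ - 1` (at the fitted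
meshes the three values are exact lattice crossing probabilities, glued by Harris's lemma through
a square crossed with probability `≥ 1/2`). [cite: BollobasRiordan2006, Ch. 3, eq. (2) and eq. (12)] -/
theorem lr_supermul_of_lt (hu : Tendsto u atTop (𝓝[>] (0 : ℝ)))
    (hg : ∀ R : ConformalRectangle, Tendsto (fun n => bondDomainCrossingProb R (u n)) atTop (𝓝 (g R)))
    {w₁ w₂ w : ℝ} (hw₁ : 1 ≤ w₁) (hw₂ : 1 ≤ w₂) (hw : 0 < w) (hww : w < w₁ + w₂ - 1)
    (L₁ : ConformalRectangle) (hLc₁ : L₁.carrier = (Ioo (0:ℝ) w₁ ×ℂ Ioo (0:ℝ) 1))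
    (hL0₁ : L₁.arc 0 = {z : ℂ | z.re = 0 ∧ z.im ∈ Icc (0:ℝ) 1})
    (hL2₁ : L₁.arc 2 = {z : ℂ | z.re = w₁ ∧ z.im ∈ Icc (0:ℝ) 1})
    (L₂ : ConformalRectangle) (hLc₂ : L₂.carrier = (Ioo (0:ℝ) w₂ ×ℂ Ioo (0:ℝ) 1))
    (hL0₂ : L₂.arc 0 = {z : ℂ | z.re = 0 ∧ z.im ∈ Icc (0:ℝ) 1})
    (hL2₂ : L₂.arc 2 = {z : ℂ | z.re = w₂ ∧ z.im ∈ Icc (0:ℝ) 1})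
    (L : ConformalRectangle) (hLc : L.carrier = (Ioo (0:ℝ) w ×ℂ Ioo (0:ℝ) 1))
    (hL0 : L.arc 0 = {z : ℂ | z.re = 0 ∧ z.im ∈ Icc (0:ℝ) 1})
    (hL2 : L.arc 2 = {z : ℂ | z.re = w ∧ z.im ∈ Icc (0:ℝ) 1}) : g L₁ * g L₂ / 2 ≤ g L := by
  have hw₁' : 0 < w₁ := one_pos.trans_le hw₁
  have hw₂' : 0 < w₂ := one_pos.trans_le hw₂
  have hd : 0 < w₁ + w₂ - 1 - w := by linarith
  obtain ⟨M, hM⟩ := exists_nat_gt (1 / (w₁ + w₂ - 1 - w))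
  refine le_of_tendsto_of_tendsto (((tendsto_fitted hu hg L₁).mul (tendsto_fitted hu hg L₂)).div_const 2)
    (tendsto_fitted hu hg L) ?_
  filter_upwards [eventually_lr_eq hu hw₁' L₁ hLc₁ hL0₁ hL2₁, eventually_lr_eq hu hw₂' L₂ hLc₂ hL0₂ hL2₂,
    eventually_lr_eq hu hw L hLc hL0 hL2, (tendsto_meshFloor hu).eventually_ge_atTop (max M 2)]
    with n hn₁ hn₂ hn hnM
  obtain ⟨a₁, -, h₁, h₁', he₁⟩ := hn₁
  obtain ⟨a₂, -, h₂, h₂', he₂⟩ := hn₂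
  obtain ⟨a, -, h, h', he⟩ := hn
  simp only [he₁, he₂, he]
  set m : ℕ := ⌊1 / u n⌋₊ with hmdef
  have hm2 : 2 ≤ m := (le_max_right _ _).trans hnM
  have hmM : (M:ℝ) ≤ m := by exact_mod_cast (le_max_left _ _).trans hnM
  have hm0 : (0:ℝ) ≤ m := Nat.cast_nonneg _
  -- `m - 2 ≤ aᵢ` since `wᵢ ≥ 1`
  have hma₁ : m - 2 ≤ a₁ := by
    have : (m:ℝ) ≤ a₁ + 2 := (le_mul_of_one_le_left hm0 hw₁).trans h₁'
    have : m ≤ a₁ + 2 := by exact_mod_cast this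
    omega
  have hma₂ : m - 2 ≤ a₂ := by
    have : (m:ℝ) ≤ a₂ + 2 := (le_mul_of_one_le_left hm0 hw₂).trans h₂'
    have : m ≤ a₂ + 2 := by exact_mod_cast this
    omega
  -- the index inequality `a ≤ a₁ + a₂ - (m - 2)` once `(w₁ + w₂ - 1 - w) m ≥ 1`
  have hidx : a ≤ a₁ + a₂ - (m - 2) := by
    have hdm : 1 < (m:ℝ) * (w₁ + w₂ - 1 - w) := by
      have h1 : 1 / (w₁ + w₂ - 1 - w) < m := hM.trans_le hmM
      rwa [div_lt_iff₀ hd] at h1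
    have e : (m:ℝ) * (w₁ + w₂ - 1 - w) = w₁ * m + w₂ * m - m - w * m := by ring
    have h3 : (a:ℝ) + m < a₁ + a₂ + 2 := by linarith
    have h4 : a + m < a₁ + a₂ + 2 := by exact_mod_cast h3
    omega
  exact crossingProb_mul_half_le hma₁ hma₂ hidx

/-- **Super-multiplicativity of the left-to-right box values of a joint limit**:
`g (L_{w₁}) · g (L_{w₂}) / 2 ≤ g (L_{w₁ + w₂ - 1})` for `w₁, w₂ ≥ 1` (the strict-width inequality
`lr_supermul_of_lt` and the continuity of the box values in the width, `lr_continuous`).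
[cite: BollobasRiordan2006, Ch. 3, eq. (2) and eq. (12)] -/
theorem lr_supermul (hu : Tendsto u atTop (𝓝[>] (0 : ℝ)))
    (hg : ∀ R : ConformalRectangle, Tendsto (fun n => bondDomainCrossingProb R (u n)) atTop (𝓝 (g R)))
    {w₁ w₂ w₀ : ℝ} (hw₁ : 1 ≤ w₁) (hw₂ : 1 ≤ w₂) (hw₀ : w₀ = w₁ + w₂ - 1)
    (L₁ : ConformalRectangle) (hLc₁ : L₁.carrier = (Ioo (0:ℝ) w₁ ×ℂ Ioo (0:ℝ) 1))
    (hL0₁ : L₁.arc 0 = {z : ℂ | z.re = 0 ∧ z.im ∈ Icc (0:ℝ) 1})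
    (hL2₁ : L₁.arc 2 = {z : ℂ | z.re = w₁ ∧ z.im ∈ Icc (0:ℝ) 1})
    (L₂ : ConformalRectangle) (hLc₂ : L₂.carrier = (Ioo (0:ℝ) w₂ ×ℂ Ioo (0:ℝ) 1))
    (hL0₂ : L₂.arc 0 = {z : ℂ | z.re = 0 ∧ z.im ∈ Icc (0:ℝ) 1})
    (hL2₂ : L₂.arc 2 = {z : ℂ | z.re = w₂ ∧ z.im ∈ Icc (0:ℝ) 1})
    (L : ConformalRectangle) (hLc : L.carrier = (Ioo (0:ℝ) w₀ ×ℂ Ioo (0:ℝ) 1))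
    (hL0 : L.arc 0 = {z : ℂ | z.re = 0 ∧ z.im ∈ Icc (0:ℝ) 1})
    (hL2 : L.arc 2 = {z : ℂ | z.re = w₀ ∧ z.im ∈ Icc (0:ℝ) 1}) : g L₁ * g L₂ / 2 ≤ g L := by
  have hw₀' : 0 < w₀ := by rw [hw₀]; linarith
  refine le_of_forall_pos_le_add fun ε hε => ?_
  obtain ⟨ρ, hρ, hcont⟩ := lr_continuous hu hg hw₀' L hLc hL0 hL2 hε
  -- a slightly shorter box, within the continuity radius
  set w : ℝ := w₀ - min ρ (w₀ / 2) with hwdef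
  have hmin : 0 < min ρ (w₀ / 2) := lt_min hρ (by positivity)
  have hmin' : min ρ (w₀ / 2) ≤ w₀ / 2 := min_le_right _ _
  have hw : 0 < w := by rw [hwdef]; linarith
  have hww : w < w₁ + w₂ - 1 := by rw [hwdef, ← hw₀]; linarith
  have hρw : |w - w₀| ≤ ρ := by
    rw [hwdef, show w₀ - min ρ (w₀ / 2) - w₀ = -min ρ (w₀ / 2) by ring, abs_neg, abs_of_pos hmin]
    exact min_le_left _ _
  obtain ⟨Lw, hcw, h0w, h2w⟩ := exists_lrBox w hw
  have h1 := lr_supermul_of_lt hu hg hw₁ hw₂ hw hww L₁ hLc₁ hL0₁ hL2₁ L₂ hLc₂ hL0₂ hL2₂ Lw hcw h0w h2w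
  have h2 := hcont w hw hρw Lw hcw h0w h2w
  have h3 : g Lw ≤ g L + ε := by linarith [(abs_le.1 h2).2]
  exact h1.trans h3

end JointLimit

/-- **Sub-goal `jointLimit_lr_supermul` (line `registered`, lead c6; kernel facts IV, part 1) —
super-multiplicativity of the long-box values of every joint sequential limit of the bond-`ℤ²`
crossing probabilities**: for `u n → 0⁺` and `bondDomainCrossingProb R (u n) → g R` (all `R`), the
values `g (L_w)` on the boxes `(0,w) × (0,1)` crossed from the left to the right side satisfy
`g L_{w₁} g L_{w₂} / 2 ≤ g L_{w₁ + w₂ - 1}` for `w₁, w₂ ≥ 1` (Harris gluing of two long crossings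
through a unit square, crossed with probability `≥ 1/2` at `p = 1/2`).
[cite: BollobasRiordan2006, Ch. 3, eq. (2) and eq. (12)] -/
theorem jointLimit_lr_supermul : ∀ u : ℕ → ℝ, Filter.Tendsto u Filter.atTop (nhdsWithin (0 : ℝ) (Set.Ioi 0)) → ∀ g : Literature.Probability.RandomPlanarGeometry.ConformalRectangle → ℝ, (∀ R : Literature.Probability.RandomPlanarGeometry.ConformalRectangle, Filter.Tendsto (fun n => Literature.Probability.Percolation.bondDomainCrossingProb R (u n)) Filter.atTop (nhds (g R))) → ∀ w₁ w₂ : ℝ, 1 ≤ w₁ → 1 ≤ w₂ → ∀ L₁ : Literature.Probability.RandomPlanarGeometry.ConformalRectangle, L₁.carrier = (Set.Ioo (0:ℝ) w₁ ×ℂ Set.Ioo (0:ℝ) 1) → L₁.arc 0 = {z : ℂ | z.re = 0 ∧ z.im ∈ Set.Icc (0:ℝ) 1} → L₁.arc 2 = {z : ℂ | z.re = w₁ ∧ z.im ∈ Set.Icc (0:ℝ) 1} → ∀ L₂ : Literature.Probability.RandomPlanarGeometry.ConformalRectangle, L₂.carrier = (Set.Ioo (0:ℝ) w₂ ×ℂ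 Set.Ioo (0:ℝ) 1) → L₂.arc 0 = {z : ℂ | z.re = 0 ∧ z.im ∈ Set.Icc (0:ℝ) 1} → L₂.arc 2 = {z : ℂ | z.re = w₂ ∧ z.im ∈ Set.Icc (0:ℝ) 1} → ∀ L : Literature.Probability.RandomPlanarGeometry.ConformalRectangle, L.carrier = (Set.Ioo (0:ℝ) (w₁ + w₂ - 1) ×ℂ Set.Ioo (0:ℝ) 1) → L.arc 0 = {z : ℂ | z.re = 0 ∧ z.im ∈ Set.Icc (0:ℝ) 1} → L.arc 2 = {z : ℂ | z.re = (w₁ + w₂ - 1) ∧ z.im ∈ Set.Icc (0:ℝ) 1} → g L₁ * g L₂ / 2 ≤ g L :=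
  fun _ hu _ hg _ _ hw₁ hw₂ L₁ hLc₁ hL0₁ hL2₁ L₂ hLc₂ hL0₂ hL2₂ L hLc hL0 hL2 =>
    JointLimit.lr_supermul hu hg hw₁ hw₂ rfl L₁ hLc₁ hL0₁ hL2₁ L₂ hLc₂ hL0₂ hL2₂ L hLc hL0 hL2

end Summit.CriticalPhenomena.CardyFormulaZ2.Cruxes.SubseqCardy.Birth

end
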